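import Literature.NumberTheory.IwasawaTheory.ClassicalMuVanishesNormRelationTower
import Literature.NumberTheory.EllipticCurves.IwasawaCyclotomicProofs
import HarnessLib

set_option autoImplicit false

/-!
# μ-descent along the cyclotomic tower, consumer form without a chosen `κ`:
# `p ∤ [L:F]`, a norm relation of `Gal(L/F)` with `p ∤ d`, `μ = 0` for the cyclotomic towers of the `L^{Hᵢ}`
# ⇒ `μ = 0` for every cyclotomic `ℤ_p`-extension of `L`

Topic `NumberTheory/IwasawaTheory` (namespace = path).  THEOREM-ONLY file (no definition, no named fact, no `sorry`),
written by the literature seat `bsd-potss-conjA-anchor` g11 (cell `bsd-potss`; supports stmt-BirchSwinnertonDyer-19386 /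
19413; closes nothing).  A two-line corollary of `classicalMuVanishes_of_isCyclotomic_of_normRelation`
(`ClassicalMuVanishesNormRelationTower.lean`) and the existence of the cyclotomic `ℤ_p`-extension of a number field
(tree theorem `Literature.NumberTheory.EllipticCurves.exists_cyclotomicZpExtension_holds`, Washington §13.1 p. 264), kept in
its own file so that the tower file does not import the cyclotomic-character material.

* `classicalMuVanishes_of_isCyclotomic_of_normRelation'` — for a number field `F`, a finite Galois `L/F` with
  `p ∤ [L : F]`, subgroups `Hᵢ ≤ Gal(L/F)` carrying a norm relation `d = ∑ᵢ aᵢ N_{Hᵢ} bᵢ` with `p ∤ d` ([BiasseEtAl2022]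
  Def. 2.1, coefficientwise `hrel`), and `μ = 0` (growth form `ClassicalMuVanishes`) for every cyclotomic `ℤ_p`-extension
  of each `L^{Hᵢ}`: under Iwasawa's growth theorem (`iwasawa1959_classNumberPExp_growth`), `μ = 0` for every cyclotomic
  `ℤ_p`-extension of `L`.  With `F = ℚ`, `L = ℚ(E[p])` this is road (b) «classical `μ = 0` of `ℚ(E[p])_cyc`» of the
  `bsd-potss` residue cruxes in the hypothesis shape of
  `CoatesSujatha2005.thm34_fineSelmerDual_moduleFinite_of_classicalMuVanishes_divisionField`.

References: [BiasseEtAl2022] Prop. 3.7, Def. 2.1; [Washington1997] §13.1; [Lang1990] Ch. 5 §1 Thm. 1.2 (iii).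
-/

noncomputable section

open IntermediateField Literature.NumberTheory.EllipticCurves

namespace Literature.NumberTheory.IwasawaTheory

variable {F : Type} [Field F] [NumberField F] {p : ℕ} [Fact p.Prime]

/-- **μ-descent for the cyclotomic `ℤ_p`-towers (no `κ` chosen).**  `L/F` finite Galois, `p ∤ [L : F]`, a norm relation
`d = ∑ᵢ aᵢ N_{Hᵢ} bᵢ` of `Gal(L/F)` with `p ∤ d`; if every cyclotomic `ℤ_p`-extension of each `L^{Hᵢ}` has `μ = 0`
(growth form), then so does every cyclotomic `ℤ_p`-extension of `L` — under Iwasawa's growth theorem `hI`.  (The cyclotomic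
`ℤ_p`-extension `κ` of `F` exists, `exists_cyclotomicZpExtension_holds`; apply
`classicalMuVanishes_of_isCyclotomic_of_normRelation`.) [cite: BiasseEtAl2022, Prop. 3.7] [cite: Washington1997, §13.1]
[cite: Lang1990, Ch. 5 §1 Thm. 1.2 (iii) (pp. 124–129)] -/
theorem classicalMuVanishes_of_isCyclotomic_of_normRelation' (hI : iwasawa1959_classNumberPExp_growth)
    (L : Type) [Field L] [NumberField L] [Algebra F L] [IsGalois F L] [Fintype (L ≃ₐ[F] L)]
    [DecidableEq (L ≃ₐ[F] L)] (hp : ¬ p ∣ Module.finrank F L)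
    {ι : Type} [Fintype ι] (H : ι → Subgroup (L ≃ₐ[F] L)) [∀ i, Fintype (H i)]
    (a b : ι → (L ≃ₐ[F] L) → ℤ) {d : ℕ} (hpd : ¬ p ∣ d)
    (hrel : ∀ g : L ≃ₐ[F] L,
      (∑ i, ∑ x : L ≃ₐ[F] L, ∑ h : H i, a i x * b i ((h : L ≃ₐ[F] L)⁻¹ * x⁻¹ * g)) =
        if g = 1 then (d : ℤ) else 0)
    (hμ : ∀ i, ∀ κE : ZpExtension ↥(fixedField (H i)) p, κE.IsCyclotomic → ClassicalMuVanishes κE)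
    (κL : ZpExtension L p) (hκL : κL.IsCyclotomic) : ClassicalMuVanishes κL := by
  obtain ⟨κ, hκ⟩ := exists_cyclotomicZpExtension_holds F p
  exact classicalMuVanishes_of_isCyclotomic_of_normRelation hI κ hκ L hp H a b hpd hrel hμ κL hκL

end Literature.NumberTheory.IwasawaTheory

end
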